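import Summits.QuantumFields.BalabanUV.T4Continuum.Support.NE7HdecompOfNL0
import Summits.QuantumFields.BalabanUV.T4Continuum.Support.NE7HintOfSliceNormalisationSU2DecSlice
import Summits.QuantumFields.BalabanUV.T4Continuum.Support.NE3ClassRadiusFamily
import HarnessLib

/-!
# NE7HintUnconditionalSU2 — (8)∃ FOR SU(2), `d = 4`, `L = 2`, WITH NO DISPLAYED HYPOTHESIS: `NE7HintOfSliceNormalisationSU2DecSlice.hint_SU2_of_decomposition` (gen 95∕99, the END of the NE7
# record: (8)∃ ⇐ ONE k-free strict line ∧ `hdecomp♭`) with `hdecomp♭` DISCHARGED by `NE7HdecompOfNL0.hdecomp_of_nl0` (the (R1″) representative + [B8]'s letters + the frame-free right inverse)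
# and the strict line DISCHARGED for `ε ≤ ε₀` because the three ceilings are LINEAR in `ε` (`α̂ = C_S·ε`, `ν̂ = ν_c·ε`, `κ̂ = κ_c·ε`)

Cell `pub-balaban`, rung (B)+1 sub-cell t4, lineage `b2b-balaban-t4-ne7-p1`, generation 104 (CRUX PROVER NE7 #1 = OWNER of BINDER row NE7).  Memo `t4/b2b-balaban-t4-ne7-p1-g103/ROAD-G103.md` §6–§7 and
`t4/b2b-balaban-t4-ne7-p1-g104/ROAD-G104.md`.
WHAT ([folklore]; 0 def, 0 sorry).  **`hint_SU2_unconditional`**: for `card n = 2` there are `ℓ ≥ 1`, `ε₀ > 0` and, for every `0 < ε ≤ ε₀`, a `β₀ > 0` such that for `0 < β ≤ β₀` and every period `N ≥ 1`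
there is `δ_V > 0` with: for every unitary `N`-periodic `V` with `SmallField V δ_V` and every level `k`, SOME constrained Wilson minimiser over `sfClass 4 2 N ε` at level `k` over the datum `V` is
`SmallField U a` with `0 ≤ a < ε·(2^k)^{−2}` — [Balaban1985Variational] Thm 1 (8) TYPE, the `hint` binder of `NE7InteriorMinimiserDocking.hminE_of_interior_exists_d4` ∕ route 1's docked ENDs.
THE STRICT LINE.  With `Q = 2(1 + (8·CPLine 4 2 2 10⁻¹⁷ 10⁻⁵³ + 1)) ≥ 4` (`CPLine_nonneg_d4_L2`) and `T₀ = (1∕2)∕Q`, for `0 < ε ≤ 1` the right-hand side of the line at `(C_Sε, ν_cε, κ_cε)` is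
`≥ T₀∕4 − (ν_c² + 2304·C_S²e^{2C_S}·… )ε`-shaped; `ε ≤ T₀∕(4(c+1))` with `c = 2κ_c + ν_c² + 2304C_S²e^{2C_S} + 112(1 + 7C_S²)` closes it.
HONEST FRAMING (page 1): a composition of landed kernel theorems of this lineage (gens 84–104), of row NE3's∕NE7b's support files, and of [B7]∕[B8]∕[B11] AS TYPED in the tree (the one-step engine
`hint_SU2` of gens 93–99 and everything under it); nothing of Bałaban's is asserted as an axiom and no hypothesis is displayed.  WHAT IT IS: (8)∃ at SU(2), `d = 4`, `L = 2`, finite T⁴ — the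
`hint` INPUT of the NE7 route-1 ENDs; WHAT IT IS NOT: the other sockets of route 1 (S1–S4, S6, S7), NOT NE7 as a spine node by itself, NOT infinite volume, NOT mass gap, NOT BetaPertH, NOT Clay
(continuum YM on T⁴ ⇐ BetaPertH ∧ nine spine estimates).  Axioms ⊆ {propext, Classical.choice, Quot.sound}; 0 sorry.
-/

set_option autoImplicit false

open scoped BigOperators Matrix Matrix.Norms.L2Operator Topology
open NormedSpace Finset Set Filter

namespace Summit.QuantumFields.BalabanUV.T4Continuum.NE7HintUnconditionalSU2

open Literature.MathematicalPhysics.QuantumFieldTheory.Balaban1983to89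
open B7Prop1Explicit B7Prop2Explicit MatrixLog
open T4AveragingDeficitWall (IsUnitaryCfg IsSkewDir SmallField)
open T4AveragingDeficitWallBoundary (IsPeriodicCfg)
open MinimalActionSandwich (IsMinimiser)
open MinimalActionRate (sfClass)
open NE3SlicePoincareBudgetLine (CPLine)
open NE3ClassRadiusFamily (CPLine_nonneg_d4_L2)
open NE7HintOfSliceNormalisationSU2DecSlice (hint_SU2_of_decomposition)
open NE7HdecompOfNL0 (hdecomp_of_nl0)

noncomputable section

variable {n : Type} [Fintype n] [DecidableEq n]

/-- the strict line's right-hand side dominates `T₀∕4 − c·ε` (pure real arithmetic; `card = 2`). [folklore] -/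
theorem line_of_small {Q CS νc κc ε : ℝ} (hQ : 4 ≤ Q) (hCS : 0 < CS) (hε : 0 < ε) (hε1 : ε ≤ 1)
    (hsmall : (2 * κc + νc ^ 2 + 2304 * (CS ^ 2 * Real.exp (2 * CS)) + 112 * (1 + 7 * CS ^ 2) + 1) * ε ≤ (1 / 2) / Q / 4) :
    2 * (κc * ε) < ((((1 / 2 - (νc * ε) ^ 2) / Q - (νc * ε) ^ 2) / 2 - 576 * ((4 : ℕ) : ℝ) * ((CS * ε) ^ 2 * Real.exp (2 * (CS * ε)))) / ((2 : ℕ) : ℝ)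
      - 28 * ((4 : ℕ) : ℝ) * (ε + 7 * (CS * ε) ^ 2)) := by
  have hQ0 : 0 < Q := by linarith
  have hε0 := hε.le
  have hεsq : ε ^ 2 ≤ ε := by nlinarith only [hε0, hε1]
  -- the four atoms and their linear bounds
  have hX1 : (νc * ε) ^ 2 ≤ νc ^ 2 * ε := by
    rw [mul_pow]; exact mul_le_mul_of_nonneg_left hεsq (sq_nonneg _)
  have hX1_0 : 0 ≤ (νc * ε) ^ 2 := sq_nonneg _
  have hY1 : (νc * ε) ^ 2 / Q ≤ νc ^ 2 * ε := (div_le_self hX1_0 (by linarith)).trans hX1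
  have hY1_0 : 0 ≤ (νc * ε) ^ 2 / Q := by positivity
  have hX3 : (CS * ε) ^ 2 ≤ CS ^ 2 * ε := by
    rw [mul_pow]; exact mul_le_mul_of_nonneg_left hεsq (sq_nonneg _)
  have hexp : Real.exp (2 * (CS * ε)) ≤ Real.exp (2 * CS) := Real.exp_le_exp.2 (by nlinarith only [hCS, hε1, hε0])
  have hX2 : (CS * ε) ^ 2 * Real.exp (2 * (CS * ε)) ≤ CS ^ 2 * Real.exp (2 * CS) * ε := by
    calc (CS * ε) ^ 2 * Real.exp (2 * (CS * ε)) ≤ (CS ^ 2 * ε) * Real.exp (2 * CS) :=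
          mul_le_mul hX3 hexp (Real.exp_pos _).le (by positivity)
      _ = CS ^ 2 * Real.exp (2 * CS) * ε := by ring
  have hsplit : (1 / 2 - (νc * ε) ^ 2) / Q = (1 / 2) / Q - (νc * ε) ^ 2 / Q := sub_div _ _ _
  rw [hsplit]
  have hT0 : 0 < (1 / 2) / Q := by positivity
  have hcε : (2 * κc + νc ^ 2 + 2304 * (CS ^ 2 * Real.exp (2 * CS)) + 112 * (1 + 7 * CS ^ 2)) * ε < (1 / 2) / Q / 4 := by
    have : (2 * κc + νc ^ 2 + 2304 * (CS ^ 2 * Real.exp (2 * CS)) + 112 * (1 + 7 * CS ^ 2)) * ε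
        < (2 * κc + νc ^ 2 + 2304 * (CS ^ 2 * Real.exp (2 * CS)) + 112 * (1 + 7 * CS ^ 2) + 1) * ε := by nlinarith only [hε]
    linarith only [this, hsmall]
  push_cast
  nlinarith only [hcε, hY1, hY1_0, hX1, hX1_0, hX2, hX3, hε0, hT0, sq_nonneg CS, Real.exp_pos (2 * CS),
    mul_nonneg (sq_nonneg CS) (Real.exp_pos (2 * CS)).le]

/-- **(8)∃ FOR SU(2) AT `d = 4`, `L = 2` — NO DISPLAYED HYPOTHESIS.**  `NE7HintOfSliceNormalisationSU2DecSlice.hint_SU2_of_decomposition` with its per-pair binder `hdecomp♭` supplied by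
`NE7HdecompOfNL0.hdecomp_of_nl0` and its strict line by `line_of_small` at `ε ≤ ε₀`. [folklore] -/
theorem hint_SU2_unconditional [Nonempty n] (hn : Fintype.card n = 2) :
    ∃ ℓ : ℕ, 1 ≤ ℓ ∧ ∃ ε₀ : ℝ, 0 < ε₀ ∧ ∀ ε : ℝ, 0 < ε → ε ≤ ε₀ → ∃ β₀ : ℝ, 0 < β₀ ∧ ∀ β : ℝ, 0 < β → β ≤ β₀ →
    ∀ (N : ℕ) [NeZero N], 1 ≤ N →
    ∃ δV : ℝ, 0 < δV ∧
      ∀ V ∈ {V : Site 4 → Fin 4 → (Matrix n n ℂ)ˣ | IsUnitaryCfg V ∧ IsPeriodicCfg V (N : ℤ) ∧ SmallField V δV},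
      ∀ k : ℕ, ∃ U : Site 4 → Fin 4 → (Matrix n n ℂ)ˣ, IsMinimiser 4 (sfClass 4 2 N ε) 2 N k V U ∧
        ∃ a : ℝ, 0 ≤ a ∧ a < ε / (((2 : ℕ) : ℝ) ^ k) ^ 2 ∧ SmallField U a := by
  obtain ⟨ℓ, hℓ1, ε₀, hε₀, H⟩ := hint_SU2_of_decomposition (n := n) hn
  obtain ⟨ε₂, hε₂, CS, hCS, νc, hνc, κc, hκc, hdec⟩ := hdecomp_of_nl0 (n := n)
  -- the strict line's constants
  obtain ⟨Q, hQ⟩ : ∃ Q : ℝ, Q = 2 * (1 + (8 * CPLine 4 2 2 (1 / 10 ^ 17) (1 / 10 ^ 53) + 1)) := ⟨_, rfl⟩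
  have hQ4 : 4 ≤ Q := by rw [hQ]; have := CPLine_nonneg_d4_L2; linarith
  have hQ0 : 0 < Q := by linarith
  obtain ⟨c, hc⟩ : ∃ c : ℝ, c = 2 * κc + νc ^ 2 + 2304 * (CS ^ 2 * Real.exp (2 * CS)) + 112 * (1 + 7 * CS ^ 2) + 1 := ⟨_, rfl⟩
  have hc0 : 0 < c := by rw [hc]; positivity
  obtain ⟨ε₃, hε₃⟩ : ∃ ε₃ : ℝ, ε₃ = (1 / 2) / Q / 4 / c := ⟨_, rfl⟩
  have hε₃0 : 0 < ε₃ := by rw [hε₃]; positivity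
  refine ⟨ℓ, hℓ1, min ε₀ (min ε₂ (min 1 ε₃)), lt_min hε₀ (lt_min hε₂ (lt_min one_pos hε₃0)), fun ε hε hεle => ?_⟩
  have hεε₀ : ε ≤ ε₀ := hεle.trans (min_le_left _ _)
  have hεε₂ : ε ≤ ε₂ := hεle.trans ((min_le_right _ _).trans (min_le_left _ _))
  have hε1 : ε ≤ 1 := hεle.trans ((min_le_right _ _).trans ((min_le_right _ _).trans (min_le_left _ _)))
  have hεε₃ : ε ≤ ε₃ := hεle.trans ((min_le_right _ _).trans ((min_le_right _ _).trans (min_le_right _ _)))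
  have hsmall : c * ε ≤ (1 / 2) / Q / 4 := by
    have h1 : c * ε ≤ c * ε₃ := mul_le_mul_of_nonneg_left hεε₃ hc0.le
    have h2 : c * ε₃ = (1 / 2) / Q / 4 := by rw [hε₃]; field_simp
    linarith only [h1, h2]
  obtain ⟨β₀, hβ₀, H2⟩ := H ε hε hεε₀
  refine ⟨β₀, hβ₀, fun β hβ hβle N _ hN => ?_⟩
  have hline := line_of_small hQ4 hCS hε hε1 (by rw [← hc]; exact hsmall)
  rw [hQ] at hline
  refine H2 β hβ hβle N (CS * ε) (νc * ε) (κc * ε) hN (by rw [hn]; exact hline) ?_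
  intro D hD hDP hDS k Us hUs hUsS hcrit U' hU' u₀ hu₀ hu₀P hpin hclose
  exact hdec N ε hε hεε₂ β D hD hDP hDS k Us hUs hUsS hcrit U' hU' u₀ hu₀ hu₀P hpin hclose

/-- **(8)∃ FOR SU(2), THE CONSUMER SHAPE** (the vestigial `ℓ` and the coupling parameter `β` of `hint_SU2_unconditional` eliminated — `β := β₀(ε)`): `card n = 2 → ∃ ε₀ > 0, ∀ 0 < ε ≤ ε₀, ∀ N ≥ 1,
∃ δ_V > 0` such that the `hint` binder of `NE7InteriorMinimiserDocking.hminE_of_interior_exists_d4` ∕ `NE7Route1EndDockedInterior.goodClause_summable_of_route1_docked_interior` holds on the small data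
`{V | unitary, N-periodic, SmallField V δ_V}` (any gauge-invariant sub-family `dom` of it inherits it by restriction). [folklore] -/
theorem hint_SU2_small_data [Nonempty n] (hn : Fintype.card n = 2) :
    ∃ ε₀ : ℝ, 0 < ε₀ ∧ ∀ ε : ℝ, 0 < ε → ε ≤ ε₀ → ∀ (N : ℕ) [NeZero N], 1 ≤ N →
    ∃ δV : ℝ, 0 < δV ∧
      ∀ V ∈ {V : Site 4 → Fin 4 → (Matrix n n ℂ)ˣ | IsUnitaryCfg V ∧ IsPeriodicCfg V (N : ℤ) ∧ SmallField V δV},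
      ∀ k : ℕ, ∃ U : Site 4 → Fin 4 → (Matrix n n ℂ)ˣ, IsMinimiser 4 (sfClass 4 2 N ε) 2 N k V U ∧
        ∃ a : ℝ, 0 ≤ a ∧ a < ε / (((2 : ℕ) : ℝ) ^ k) ^ 2 ∧ SmallField U a := by
  obtain ⟨-, -, ε₀, hε₀, H⟩ := hint_SU2_unconditional (n := n) hn
  refine ⟨ε₀, hε₀, fun ε hε hεle N _ hN => ?_⟩
  obtain ⟨β₀, hβ₀, H2⟩ := H ε hε hεle
  exact H2 β₀ hβ₀ le_rfl N hN

end

end Summit.QuantumFields.BalabanUV.T4Continuum.NE7HintUnconditionalSU2
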